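import Summits.CriticalPhenomena.PercolationContinuityZ3.Theorems.PercNearOneGluingNoHeavyQuantLongTailPairHubAlg
import HarnessLib

/-!
# QUANT lane R8, T-DEC: THE LONG-TAIL PAIR HUB, ROUTE FILE — the torque-cost route of the low atom `2lo` of the width-2 hub `S(γ₁) ∗ S(γ₂)` of shape
# `{lo, lo+K; γ}`, `2lo ≤ K ≤ 4lo`, at ONE outer gate: middle atom while its credit capacity lasts, top afterwards (census-1 gen 32)

builds on p205010 (kernel theorem, internal audit signed; external expert review pending)

Support file (`--supports stmt-CriticalPhenomena-4575`), QUANT lane seat prim-quant-census-1 (gen 32); memo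
`run/shared/lean/prim/quant/prim-quant-census-1/g32/TWOLO-G32.md` §3–§4.  Theorems only, standard axioms, no sorries.  The SDEC theorem is
`…QuantLongTailPairHub` (`sdec_sHub_two_long`); the closed forms are `…QuantLongTailPairHubAlg`.  Uses g30/g31's route algebra (`pieceBlob_costA`,
`cost_le_of_theta`, `rate_mul_le_of_theta`) and arm-1 g50's `freeRate`.
* **`pairHubLong_costTop`** — the top route's torque cost in the floor regime `θ = y`: with `u₀ = (1−g)(1−h)`, `u₁ = g(1−h)+h(1−g)`,
  `T₀ = 2lo + K(g+h)`, exhausted middle credit `K·u₁ < (T−4lo)(u₀+u₁)` and `T ≤ T₀` give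
  `0 ≤ (T₀ − xT)(u₀(T−2lo) + u₁(T−2lo−K)) − (2lo+2K−T)·xT·u₀`: a CONCAVE quadratic in `T` on `[τ, T₀]` (`τ = 4lo + K·u₁/(u₀+u₁)`), nonnegative at
  `T₀` by the top's floor capacity (`ltPair_capTop`) and the torque identity `u₀(T₀−2lo) + u₁(T₀−2lo−K) = u₂(2lo+2K−T₀)`, and at `τ` by `ltPair_cost0`
  (there `u₀(τ−2lo) + u₁(τ−2lo−K) = 2lo(u₀+u₁)` and `(2lo+2K−τ)(u₀+u₁) = (2K−2lo)u₀ + (K−2lo)u₁`); `quad_concave_between`.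
* **`pairHubLong_route`** — THE CERTIFICATE per outer gate `a` (`ν` the gated law, `T = aT₀ > 4lo`, `y = ax`): a target `t ∈ {2lo+K, 2lo+2K}` for the
  low `2lo` with `T < 2lo + t`, capacity `freeRate(y,T,2lo,t)·ν(2lo) ≤ ν(t)` and torque cost within `Σ_{0<l<T} ν(l)(T−l)`: the middle atom while
  `(T−4lo)(ν(2lo)+ν(2lo+K)) ≤ K·ν(2lo+K)` (then `T < 4lo+K`; floor capacity `y ≤ x ≤ u₁/(u₀+u₁)` by `ltPair_capMid`; cost only for `T < 2lo+K`, from the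
  low's own lever since `max(y,ρ)·K ≤ T−2lo`), the top afterwards (credit capacity `ltPair_capRho`; floor capacity `ltPair_capTop`; `T > 2lo+K` by
  `ltPair_above`, so both levers `ν(2lo)(T−2lo) + ν(2lo+K)(T−2lo−K)` are in the budget; cost with `θ = ρ` from the low's lever, with `θ = y` by
  `pairHubLong_costTop`).

HONEST STATUS.  Route bookkeeping; `SiblingStep`, `GluedDominatedMass`, `SDECConvClosed`, `FarTreeRow` OPEN; RATE class (log\*) / honest sentence of
`run/shared/lean/prim/quant/README.md` unchanged.  [this work].  Nothing here is cited as a published result.  The gluing rows served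
[cite: KozmaNitzan2024, Conjecture 3 (p. 15)]; product measure [cite: Grimmett1999, §1.3 p. 10].
-/

noncomputable section

open scoped BigOperators

namespace Summit.CriticalPhenomena.PercolationContinuityZ3.Theorems
namespace Quant
namespace LawDec

open Finset

/-! ### The top route's cost -/

/-- **the top route's torque cost in the floor regime** (`θ = y`): with `u₀ = (1−g)(1−h)`, `u₁ = g(1−h)+h(1−g)`, `T₀ = 2lo + K(g+h)`, when the
middle atom's credit is exhausted (`K·u₁ < (T−4lo)(u₀+u₁)`) and `T ≤ T₀`:
`0 ≤ (T₀ − xT)·(u₀(T−2lo) + u₁(T−2lo−K)) − (2lo+2K−T)·xT·u₀` — a concave quadratic in `T` on `[τ, T₀]`, `τ = 4lo + K·u₁/(u₀+u₁)`, nonnegative at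
`T₀` (the top's floor capacity and the torque identity) and at `τ` (`ltPair_cost0`). [this work] -/
theorem pairHubLong_costTop (lo K g h x T : ℝ) (hlo0 : 0 < lo) (hK2R : 2 * lo ≤ K) (hK4R : K ≤ 4 * lo) (hg : lo ≤ K * g) (hgh : g ≤ h)
    (hh1 : h < 1) (hx0 : 0 < x) (hxg : x * (lo + K) ≤ lo + K * g)
    (hbr' : K * (g * (1 - h) + h * (1 - g)) < (T - 4 * lo) * ((1 - g) * (1 - h) + (g * (1 - h) + h * (1 - g))))
    (hTle : T ≤ 2 * lo + K * (g + h)) :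
    0 ≤ (2 * lo + K * (g + h) - x * T) * ((1 - g) * (1 - h) * (T - 2 * lo) + (g * (1 - h) + h * (1 - g)) * (T - (2 * lo + K)))
      - (2 * lo + 2 * K - T) * (x * T) * ((1 - g) * (1 - h)) := by
  have hK0 : (0 : ℝ) < K := by linarith
  have hg0 : 0 < g := by
    by_contra hc; push Not at hc
    have : K * g ≤ 0 := mul_nonpos_of_nonneg_of_nonpos hK0.le hc
    linarith
  have hg1 : g < 1 := lt_of_le_of_lt hgh hh1
  set u0 : ℝ := (1 - g) * (1 - h) with hu0
  set u1 : ℝ := g * (1 - h) + h * (1 - g) with hu1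
  set u2 : ℝ := g * h with hu2
  have hu0p : 0 < u0 := mul_pos (by linarith) (by linarith)
  have hu1n : 0 ≤ u1 := by rw [hu1]; exact add_nonneg (mul_nonneg hg0.le (by linarith)) (mul_nonneg (by linarith) (by linarith))
  have hu2n : 0 ≤ u2 := by rw [hu2]; exact mul_nonneg hg0.le (by linarith)
  set W : ℝ := u0 + u1 with hW
  have hWp : 0 < W := by linarith
  have hWne : W ≠ 0 := hWp.ne'
  have eW : W = 1 - g * h := by rw [hW, hu0, hu1]; ring
  set T₀ : ℝ := 2 * lo + K * (g + h) with hT₀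
  have hT0p : 0 < T₀ := by
    have := mul_pos hK0 (by linarith : 0 < g + h); rw [hT₀]; linarith
  have hT0top : T₀ < 2 * lo + 2 * K := by
    have := mul_lt_mul_of_pos_left (by linarith : g + h < 2) hK0; rw [hT₀]; linarith
  have hB0 : (0 : ℝ) < lo + K := by linarith
  set D : ℝ := T - 4 * lo with hD
  have hDle : D ≤ K * (g + h) - 2 * lo := by rw [hD]; rw [hT₀] at hTle; linarith
  -- the middle's credit is exhausted at `a = 1`: `gh(2K+2lo−K(g+h)) > 2lo`
  have htopAlg : 2 * lo < g * h * (2 * K + 2 * lo - K * (g + h)) := by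
    have e : (K * (g + h) - 2 * lo) * W - K * u1 = g * h * (2 * K + 2 * lo - K * (g + h)) - 2 * lo := by rw [hW, hu0, hu1]; ring
    have : D * W ≤ (K * (g + h) - 2 * lo) * W := mul_le_mul_of_nonneg_right hDle hWp.le
    linarith
  have hxu2 : x * (u0 + u2) ≤ u2 := by
    have h1 := ltPair_capTop lo K g h hlo0 hK2R hK4R hgh hh1.le htopAlg
    rw [← hu0, ← hu2] at h1
    have h2 : x * (lo + K) * (u0 + u2) ≤ (lo + K * g) * (u0 + u2) :=
      mul_le_mul_of_nonneg_right hxg (add_nonneg hu0p.le hu2n)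
    have h3 : (lo + K) * (x * (u0 + u2)) ≤ (lo + K) * u2 := by linarith
    exact le_of_mul_le_mul_left h3 hB0

  -- the quadratic `Ψ(S) = (T₀ − xS)(u0(S−2lo) + u1(S−2lo−K)) − (2lo+2K−S)·xS·u0`
  have hΨT0 : 0 ≤ (T₀ - x * T₀) * (u0 * (T₀ - 2 * lo) + u1 * (T₀ - (2 * lo + K))) - (2 * lo + 2 * K - T₀) * (x * T₀) * u0 := by
    have torque : u0 * (T₀ - 2 * lo) + u1 * (T₀ - (2 * lo + K)) = u2 * (2 * lo + 2 * K - T₀) := by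
      rw [hu0, hu1, hu2, hT₀]; ring
    rw [torque]
    have e : (T₀ - x * T₀) * (u2 * (2 * lo + 2 * K - T₀)) - (2 * lo + 2 * K - T₀) * (x * T₀) * u0
        = T₀ * (2 * lo + 2 * K - T₀) * (u2 - x * (u0 + u2)) := by ring
    rw [e]
    exact mul_nonneg (mul_nonneg hT0p.le (by linarith)) (by linarith)
  -- the switching point `τ = 4lo + K·u1/W`
  set τ : ℝ := 4 * (lo : ℝ) + K * u1 / W with hτ
  have hτW : τ * W = 4 * (lo : ℝ) * W + K * u1 := by rw [hτ, add_mul, div_mul_cancel₀ _ hWne]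
  have hτT : τ ≤ T := by
    have hDW : D * W = T * W - 4 * (lo : ℝ) * W := by rw [hD]; ring
    have : τ * W ≤ T * W := by rw [hτW]; linarith
    exact le_of_mul_le_mul_right this hWp
  have hτT0 : τ ≤ T₀ := le_trans hτT hTle
  have hC0 := ltPair_cost0 (lo : ℝ) K g h hlo0 hK2R hK4R hg hgh hh1.le
  -- `x·u0·[(2K−2lo)u0 + (K−2lo)u1] ≤ 2lo(1−x)W²`
  have hC0x : x * u0 * ((2 * K - 2 * lo) * u0 + (K - 2 * lo) * u1) ≤ 2 * lo * (1 - x) * W ^ 2 := by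
    have hbr0 : 0 ≤ (2 * K - 2 * (lo : ℝ)) * u0 + (K - 2 * lo) * u1 := by
      have : 0 ≤ (2 * (K : ℝ) - 2 * lo) * u0 := mul_nonneg (by linarith) hu0p.le
      have : 0 ≤ ((K : ℝ) - 2 * lo) * u1 := mul_nonneg (by linarith) hu1n
      linarith
    have h1 : ((lo : ℝ) + K * g) * u0 * ((2 * K - 2 * lo) * u0 + (K - 2 * lo) * u1) ≤ 2 * lo * K * (1 - g) * W ^ 2 := by
      have := mul_le_mul_of_nonneg_left hC0 (by linarith : (0 : ℝ) ≤ 1 - g)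
      rw [eW, hu0, hu1]; linarith
    have h2 : x * ((lo : ℝ) + K) * (u0 * ((2 * K - 2 * lo) * u0 + (K - 2 * lo) * u1))
        ≤ ((lo : ℝ) + K * g) * (u0 * ((2 * K - 2 * lo) * u0 + (K - 2 * lo) * u1)) :=
      mul_le_mul_of_nonneg_right hxg (mul_nonneg hu0p.le hbr0)
    have h3 : (K : ℝ) * (1 - g) ≤ (1 - x) * ((lo : ℝ) + K) := by linarith
    have h4 : 2 * lo * K * (1 - g) * W ^ 2 ≤ 2 * lo * ((1 - x) * ((lo : ℝ) + K)) * W ^ 2 := by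
      have := mul_le_mul_of_nonneg_left h3 (by positivity : (0 : ℝ) ≤ 2 * lo * W ^ 2); linarith
    have h5 : ((lo : ℝ) + K) * (x * u0 * ((2 * K - 2 * lo) * u0 + (K - 2 * lo) * u1))
        ≤ ((lo : ℝ) + K) * (2 * lo * (1 - x) * W ^ 2) := by linarith
    exact le_of_mul_le_mul_left h5 hB0
  have hΨτ : 0 ≤ (T₀ - x * τ) * (u0 * (τ - 2 * lo) + u1 * (τ - (2 * lo + K))) - (2 * lo + 2 * K - τ) * (x * τ) * u0 := by
    have e1 : u0 * (τ - 2 * lo) + u1 * (τ - (2 * lo + K)) = 2 * lo * W := by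
      have : (u0 * (τ - 2 * lo) + u1 * (τ - (2 * lo + K))) * W = (2 * lo * W) * W := by
        have e : (u0 * (τ - 2 * lo) + u1 * (τ - (2 * lo + K))) * W
            = (τ * W) * (u0 + u1) - (2 * lo * u0 + (2 * lo + K) * u1) * W := by ring
        rw [e, hτW, hW]; ring
      exact mul_right_cancel₀ hWp.ne' this
    have e2 : (2 * lo + 2 * K - τ) * W = (2 * K - 2 * lo) * u0 + (K - 2 * lo) * u1 := by
      have e : (2 * lo + 2 * K - τ) * W = (2 * lo + 2 * K) * W - τ * W := by ring
      rw [e, hτW, hW]; ring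
    rw [e1]
    -- multiply by `W > 0`
    have key : 0 ≤ ((T₀ - x * τ) * (2 * lo * W) - (2 * lo + 2 * K - τ) * (x * τ) * u0) * W := by
      have e : ((T₀ - x * τ) * (2 * lo * W) - (2 * lo + 2 * K - τ) * (x * τ) * u0) * W
          = (T₀ - x * τ) * (2 * lo * W ^ 2) - (x * τ) * u0 * ((2 * lo + 2 * K - τ) * W) := by ring
      rw [e, e2]
      have m1 : T₀ - x * T₀ ≤ T₀ - x * τ := by have := mul_le_mul_of_nonneg_left hτT0 hx0.le; linarith
      have m2 : (x * τ) * u0 * ((2 * K - 2 * lo) * u0 + (K - 2 * lo) * u1)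
          ≤ (x * T₀) * u0 * ((2 * K - 2 * lo) * u0 + (K - 2 * lo) * u1) := by
        have hbr0 : 0 ≤ u0 * ((2 * K - 2 * (lo : ℝ)) * u0 + (K - 2 * lo) * u1) := by
          have : 0 ≤ (2 * (K : ℝ) - 2 * lo) * u0 := mul_nonneg (by linarith) hu0p.le
          have : 0 ≤ ((K : ℝ) - 2 * lo) * u1 := mul_nonneg (by linarith) hu1n
          exact mul_nonneg hu0p.le (by linarith)
        have := mul_le_mul_of_nonneg_right (mul_le_mul_of_nonneg_left hτT0 hx0.le) hbr0
        linarith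
      have m3 : (T₀ - x * T₀) * (2 * lo * W ^ 2) - (x * T₀) * u0 * ((2 * K - 2 * lo) * u0 + (K - 2 * lo) * u1)
          = T₀ * (2 * lo * (1 - x) * W ^ 2 - x * u0 * ((2 * K - 2 * lo) * u0 + (K - 2 * lo) * u1)) := by ring
      have m4 : 0 ≤ T₀ * (2 * lo * (1 - x) * W ^ 2 - x * u0 * ((2 * K - 2 * lo) * u0 + (K - 2 * lo) * u1)) :=
        mul_nonneg hT0p.le (by linarith)
      have m5 : (T₀ - x * T₀) * (2 * lo * W ^ 2) ≤ (T₀ - x * τ) * (2 * lo * W ^ 2) :=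
        mul_le_mul_of_nonneg_right m1 (by positivity)
      linarith
    exact nonneg_of_mul_nonneg_left key hWp
  -- concavity between `τ` and `T₀`: `Ψ(S) = α + βS − κS²`
  set α : ℝ := -(T₀ * (2 * lo * u0 + (2 * lo + K) * u1)) with hα
  set β : ℝ := T₀ * (u0 + u1) + x * (2 * lo * u0 + (2 * lo + K) * u1) - (2 * lo + 2 * K) * x * u0 with hβ
  set κ : ℝ := x * u1 with hκ
  have eΨ : ∀ S : ℝ, (T₀ - x * S) * (u0 * (S - 2 * lo) + u1 * (S - (2 * lo + K))) - (2 * lo + 2 * K - S) * (x * S) * u0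
      = α + β * S - κ * S ^ 2 := by
    intro S; rw [hα, hβ, hκ]; ring
  have h1 : 0 ≤ α + β * τ - κ * τ ^ 2 := by rw [← eΨ τ]; exact hΨτ
  have h2 : 0 ≤ α + β * T₀ - κ * T₀ ^ 2 := by rw [← eΨ T₀]; exact hΨT0
  have hquad := quad_concave_between (by rw [hκ]; exact mul_nonneg hx0.le hu1n) h1 h2 hτT hTle
  have hΨT : 0 ≤ (T₀ - x * T) * (u0 * (T - 2 * lo) + u1 * (T - (2 * lo + K))) - (2 * lo + 2 * K - T) * (x * T) * u0 := by
    rw [eΨ T]; exact hquad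
  exact hΨT

/-! ### The route of the long-tail pair hub -/

/-- **the route of the long-tail pair hub at one outer gate** (`ν` the gated law with masses `a·u₀, a·u₁, a·u₂` at `2lo, 2lo+K, 2lo+2K`, `y = ax` the
gated floor, `T = a(2lo + K(g+h)) > 4lo` the gated mean, `g ≤ h` the two piece gates): a target `t` for the low atom `2lo` — the middle atom while
`(T−4lo)(ν(2lo)+ν(2lo+K)) ≤ K·ν(2lo+K)`, the top after — with its compatibility, capacity and torque-cost facts. [this work] -/
theorem pairHubLong_route (lo K : ℕ) (hloK : lo < K) (hK2 : 2 * lo ≤ K) (hK4 : K ≤ 4 * lo) (ν : ℕ → ℝ) (y T a g h x : ℝ)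
    (g0 : ∀ h, 0 ≤ ν h) (hgh : g ≤ h) (hg : (lo : ℝ) ≤ K * g) (hh1 : h < 1) (hx0 : 0 < x) (hxg : x * ((lo : ℝ) + K) ≤ lo + K * g)
    (ha0 : 0 < a) (ha1 : a ≤ 1) (hy : y = a * x) (hT : T = a * (2 * (lo : ℝ) + K * (g + h))) (hT4 : 4 * (lo : ℝ) < T)
    (v0 : ν (2 * lo) = a * ((1 - g) * (1 - h))) (v1 : ν (2 * lo + K) = a * (g * (1 - h) + h * (1 - g))) (v2 : ν (2 * lo + 2 * K) = a * (g * h)) :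
    ∃ t : ℕ, (t = 2 * lo + K ∨ t = 2 * lo + 2 * K) ∧ (T < ((2 * lo : ℕ) : ℝ) + (t : ℝ)) ∧
      freeRate y T (2 * lo) t * ν (2 * lo) ≤ ν t ∧
      (if T < (t : ℝ) then ((t : ℝ) - T) * (freeRate y T (2 * lo) t * ν (2 * lo)) else 0)
        ≤ ∑ l ∈ Finset.range (2 * lo + 2 * K + 1), (if (1 ≤ l ∧ (l : ℝ) < T) then ν l * (T - l) else 0) := by
  -- scalars
  have hlo1 : 1 ≤ lo := by omega
  have hloR : (1 : ℝ) ≤ lo := by exact_mod_cast hlo1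
  have hlo0 : (0 : ℝ) < lo := by linarith
  have hKR : (lo : ℝ) < K := by exact_mod_cast hloK
  have hK2R : 2 * (lo : ℝ) ≤ K := by exact_mod_cast hK2
  have hK4R : (K : ℝ) ≤ 4 * lo := by exact_mod_cast hK4
  have hK0 : (0 : ℝ) < K := by linarith
  have hg0 : 0 < g := by
    by_contra hc; push Not at hc
    have : (K : ℝ) * g ≤ 0 := mul_nonpos_of_nonneg_of_nonpos hK0.le hc
    linarith
  have hg1 : g < 1 := lt_of_le_of_lt hgh hh1
  have hh : (lo : ℝ) ≤ K * h := le_trans hg (mul_le_mul_of_nonneg_left hgh hK0.le)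
  set u0 : ℝ := (1 - g) * (1 - h) with hu0
  set u1 : ℝ := g * (1 - h) + h * (1 - g) with hu1
  set u2 : ℝ := g * h with hu2
  have hu0p : 0 < u0 := mul_pos (by linarith) (by linarith)
  have hu1n : 0 ≤ u1 := by rw [hu1]; exact add_nonneg (mul_nonneg hg0.le (by linarith)) (mul_nonneg (by linarith) (by linarith))
  have hu2n : 0 ≤ u2 := by rw [hu2]; exact mul_nonneg hg0.le (by linarith)
  have hW0 : 0 ≤ u0 + u1 := by linarith
  set W : ℝ := u0 + u1 with hW
  have hWp : 0 < W := by linarith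
  have hWne : W ≠ 0 := hWp.ne'
  have eW : W = 1 - g * h := by rw [hW, hu0, hu1]; ring
  set T₀ : ℝ := 2 * (lo : ℝ) + K * (g + h) with hT₀
  have hT0p : 0 < T₀ := by
    have := mul_pos hK0 (by linarith : 0 < g + h); rw [hT₀]; linarith
  have hTle : T ≤ T₀ := by
    have := mul_le_mul_of_nonneg_right ha1 hT0p.le; rw [hT]; linarith
  have hT0top : T₀ < 2 * (lo : ℝ) + 2 * K := by
    have := mul_lt_mul_of_pos_left (by linarith : g + h < 2) hK0; rw [hT₀]; linarith
  have hx1 : x < 1 := by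
    have : (lo : ℝ) + K * g < lo + K := by have := mul_lt_mul_of_pos_left hg1 hK0; linarith
    by_contra hc; push Not at hc
    have : 1 * ((lo : ℝ) + K) ≤ x * (lo + K) := mul_le_mul_of_nonneg_right hc (by linarith)
    linarith
  have hyx : y ≤ x := by rw [hy]; have := mul_le_mul_of_nonneg_right ha1 hx0.le; linarith
  have hy0 : 0 < y := by rw [hy]; exact mul_pos ha0 hx0
  have hy1 : y < 1 := lt_of_le_of_lt hyx hx1
  -- floor facts: `x(lo+K)(u0+u1) ≤ (lo+K)u1` and `2xK ≤ T₀`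
  have hB0 : (0 : ℝ) < (lo : ℝ) + K := by linarith
  have hxu1 : x * W ≤ u1 := by
    have h1 := ltPair_capMid (lo : ℝ) K g h hK0.le hg hgh hh1.le
    rw [← hu0, ← hu1, ← hW] at h1
    have h2 : x * ((lo : ℝ) + K) * W ≤ ((lo : ℝ) + K * g) * W := mul_le_mul_of_nonneg_right hxg hWp.le
    have h3 : ((lo : ℝ) + K) * (x * W) ≤ ((lo : ℝ) + K) * u1 := by linarith
    exact le_of_mul_le_mul_left h3 hB0
  have hxK : 2 * (x * K) ≤ T₀ := by
    have h1 : 0 ≤ x * lo := mul_nonneg hx0.le hlo0.le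
    have h2 := mul_le_mul_of_nonneg_left hgh hK0.le
    rw [hT₀]; linarith
  -- the budget terms
  set D : ℝ := T - 4 * (lo : ℝ) with hD
  have hDp : 0 < D := by rw [hD]; linarith
  have hDle : D ≤ K * (g + h) - 2 * lo := by rw [hD, hT₀] at *; linarith
  set F : ℕ → ℝ := fun l => if (1 ≤ l ∧ (l : ℝ) < T) then ν l * (T - l) else 0 with hF
  clear_value F
  have Fnn : ∀ l ∈ Finset.range (2 * lo + 2 * K + 1), 0 ≤ F l := by
    intro l _; rw [hF]; dsimp only; split_ifs with hc
    · exact mul_nonneg (g0 l) (by linarith [hc.2])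
    · exact le_rfl
  have c2lo : ((2 * lo : ℕ) : ℝ) = 2 * (lo : ℝ) := by push_cast; ring
  have Flo : F (2 * lo) = ν (2 * lo) * (T - 2 * (lo : ℝ)) := by
    rw [hF]; dsimp only; rw [if_pos ⟨by omega, by rw [c2lo]; linarith⟩, c2lo]
  have budlo : ν (2 * lo) * (T - 2 * (lo : ℝ)) ≤ ∑ l ∈ Finset.range (2 * lo + 2 * K + 1), F l := by
    rw [← Flo]; exact Finset.single_le_sum Fnn (Finset.mem_range.2 (by omega))
  have bud2 : 2 * (lo : ℝ) + K < T →
      ν (2 * lo) * (T - 2 * (lo : ℝ)) + ν (2 * lo + K) * (T - (2 * (lo : ℝ) + K)) ≤ ∑ l ∈ Finset.range (2 * lo + 2 * K + 1), F l := by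
    intro hTA1
    have cA1 : ((2 * lo + K : ℕ) : ℝ) = 2 * (lo : ℝ) + K := by push_cast; ring
    have Fmid : F (2 * lo + K) = ν (2 * lo + K) * (T - (2 * (lo : ℝ) + K)) := by
      rw [hF]; dsimp only; rw [if_pos ⟨by omega, by rw [cA1]; exact hTA1⟩, cA1]
    have hsub : ({2 * lo, 2 * lo + K} : Finset ℕ) ⊆ Finset.range (2 * lo + 2 * K + 1) := by
      intro l hl; simp only [Finset.mem_insert, Finset.mem_singleton] at hl; simp only [Finset.mem_range]; omega
    have hs := Finset.sum_le_sum_of_subset_of_nonneg hsub (fun l hl _ => Fnn l hl)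
    have e : ∑ l ∈ ({2 * lo, 2 * lo + K} : Finset ℕ), F l = F (2 * lo) + F (2 * lo + K) := by
      have n1 : 2 * lo ∉ ({2 * lo + K} : Finset ℕ) := by simp only [Finset.mem_singleton]; omega
      rw [Finset.sum_insert n1, Finset.sum_singleton]
    rw [e, Flo, Fmid] at hs; exact hs
  -- the two regimes
  by_cases hbr : D * (ν (2 * lo) + ν (2 * lo + K)) ≤ K * ν (2 * lo + K)
  · -- regime A: everything to the middle atom `2lo + K`
    have hbr' : D * W ≤ K * u1 := by
      rw [v0, v1] at hbr
      have : a * (D * W) ≤ a * (K * u1) := by rw [hW]; linarith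
      exact le_of_mul_le_mul_left this ha0
    have hDK : D < K := by
      by_contra hc; push Not at hc
      have h1 : K * W ≤ D * W := mul_le_mul_of_nonneg_right hc hWp.le
      have e : K * W = K * u0 + K * u1 := by rw [hW]; ring
      have h2 := mul_pos hK0 hu0p
      linarith
    have ed : (((2 * lo + K : ℕ) : ℝ) - ((2 * lo : ℕ) : ℝ)) = K := by push_cast; ring
    have eD : T - 2 * (((2 * lo : ℕ) : ℝ)) = D := by rw [c2lo, hD]; ring
    have eθ : freeRate y T (2 * lo) (2 * lo + K) = max y (D / K) / (1 - max y (D / K)) := by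
      unfold freeRate; rw [ed, eD]
    have hρ1 : D / K < 1 := by rw [div_lt_one hK0]; exact hDK
    have hθ1 : max y (D / K) < 1 := max_lt hy1 hρ1
    -- capacity
    have hcap : max y (D / K) * (ν (2 * lo) + ν (2 * lo + K)) ≤ ν (2 * lo + K) := by
      rw [max_mul_of_nonneg _ _ (add_nonneg (g0 _) (g0 _))]
      refine max_le ?_ ?_
      · rw [v0, v1]
        have h1 : y * W ≤ x * W := mul_le_mul_of_nonneg_right hyx hWp.le
        have h2 : a * (y * W) ≤ a * u1 := mul_le_mul_of_nonneg_left (le_trans h1 hxu1) ha0.le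
        rw [hW] at h2; linarith
      · rw [div_mul_eq_mul_div, div_le_iff₀ hK0]; rw [hW] at hbr'; linarith
    -- the near-side cost `θ·K ≤ T − 2lo`
    have hθs : max y (D / K) * ((((2 * lo + K : ℕ) : ℝ)) - 2 * (lo : ℝ)) ≤ T - 2 * (lo : ℝ) := by
      have eK : (((2 * lo + K : ℕ) : ℝ)) - 2 * (lo : ℝ) = K := by push_cast; ring
      rw [eK]
      rcases le_total y (D / K) with hle | hle
      · rw [max_eq_right hle, div_mul_cancel₀ _ hK0.ne']; rw [hD]; linarith
      · rw [max_eq_left hle, hy]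
        have h2 : a * (2 * (x * K)) ≤ a * T₀ := mul_le_mul_of_nonneg_left hxK ha0.le
        rw [hD] at hDp
        linarith
    refine ⟨2 * lo + K, Or.inl rfl, by push_cast; linarith, ?_, ?_⟩
    · rw [eθ]; exact rate_mul_le_of_theta hθ1 hcap (g0 _)
    · refine le_trans ?_ budlo
      split_ifs with hT4'
      · have c4 := pieceBlob_costA (lo := 2 * (lo : ℝ)) hθs (g0 (2 * lo))
        have c4' := cost_le_of_theta hθ1 c4
        rw [eθ]; exact c4'
      · exact mul_nonneg (g0 _) (by linarith)
  · -- regime B: everything to the top `2lo + 2K`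
    have hbr' : K * u1 < D * W := by
      have hc := lt_of_not_ge hbr
      rw [v0, v1] at hc
      have : a * (K * u1) < a * (D * W) := by rw [hW]; linarith
      exact lt_of_mul_lt_mul_left this ha0.le
    -- the middle's credit is exhausted at `a = 1`: `gh(2K+2lo−K(g+h)) > 2lo`
    have htopAlg : 2 * (lo : ℝ) < g * h * (2 * K + 2 * lo - K * (g + h)) := by
      have e : (K * (g + h) - 2 * lo) * W - K * u1 = g * h * (2 * K + 2 * lo - K * (g + h)) - 2 * lo := by rw [hW, hu0, hu1]; ring
      have : D * W ≤ (K * (g + h) - 2 * lo) * W := mul_le_mul_of_nonneg_right hDle hWp.le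
      linarith
    have ed : (((2 * lo + 2 * K : ℕ) : ℝ) - ((2 * lo : ℕ) : ℝ)) = 2 * K := by push_cast; ring
    have eD : T - 2 * (((2 * lo : ℕ) : ℝ)) = D := by rw [c2lo, hD]; ring
    have eθ : freeRate y T (2 * lo) (2 * lo + 2 * K) = max y (D / (2 * K)) / (1 - max y (D / (2 * K))) := by
      unfold freeRate; rw [ed, eD]
    have hK20 : (0 : ℝ) < 2 * K := by linarith
    have hρ1 : D / (2 * K) < 1 := by rw [div_lt_one hK20]; linarith
    have hθ1 : max y (D / (2 * K)) < 1 := max_lt hy1 hρ1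
    have hθ0 : 0 ≤ max y (D / (2 * K)) := le_trans hy0.le (le_max_left _ _)
    -- capacities
    have hxu2 : x * (u0 + u2) ≤ u2 := by
      have h1 := ltPair_capTop (lo : ℝ) K g h hlo0 hK2R hK4R hgh hh1.le htopAlg
      rw [← hu0, ← hu2] at h1
      have h2 : x * ((lo : ℝ) + K) * (u0 + u2) ≤ ((lo : ℝ) + K * g) * (u0 + u2) :=
        mul_le_mul_of_nonneg_right hxg (add_nonneg hu0p.le hu2n)
      have h3 : ((lo : ℝ) + K) * (x * (u0 + u2)) ≤ ((lo : ℝ) + K) * u2 := by linarith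
      exact le_of_mul_le_mul_left h3 hB0
    have hcap : max y (D / (2 * K)) * (ν (2 * lo) + ν (2 * lo + 2 * K)) ≤ ν (2 * lo + 2 * K) := by
      rw [max_mul_of_nonneg _ _ (add_nonneg (g0 _) (g0 _))]
      refine max_le ?_ ?_
      · rw [v0, v2]
        have h1 : y * (u0 + u2) ≤ x * (u0 + u2) := mul_le_mul_of_nonneg_right hyx (add_nonneg hu0p.le hu2n)
        have h2 : a * (y * (u0 + u2)) ≤ a * u2 := mul_le_mul_of_nonneg_left (le_trans h1 hxu2) ha0.le
        linarith
      · rw [v0, v2, div_mul_eq_mul_div, div_le_iff₀ hK20]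
        have h1 := ltPair_capRho (lo : ℝ) K g h hlo0 hK2R hK4R hg hh hg1.le hh1.le
        rw [← hu0, ← hu2] at h1
        have h2 : D * (u0 + u2) ≤ (K * (g + h) - 2 * lo) * (u0 + u2) := mul_le_mul_of_nonneg_right hDle (add_nonneg hu0p.le hu2n)
        have h3 : a * (D * (u0 + u2)) ≤ a * (2 * K * u2) := mul_le_mul_of_nonneg_left (le_trans h2 h1) ha0.le
        linarith
    -- the switch happens above the middle atom: `2lo + K < T`
    have hTA1 : 2 * (lo : ℝ) + K < T := by
      have h1 := ltPair_above (lo : ℝ) K g h hlo0 hK2R hK4R hg hh hg1.le hh1.le htopAlg.le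
      have eu1 : g + h - 2 * (g * h) = u1 := by rw [hu1]; ring
      rw [← eW, eu1] at h1
      have h3 : (K - 2 * (lo : ℝ)) * W < D * W := lt_of_le_of_lt h1 hbr'
      have h4 : (K : ℝ) - 2 * lo < D := lt_of_mul_lt_mul_right h3 hWp.le
      rw [hD] at h4; linarith
    refine ⟨2 * lo + 2 * K, Or.inr rfl, by push_cast; linarith, ?_, ?_⟩
    · rw [eθ]; exact rate_mul_le_of_theta hθ1 hcap (g0 _)
    · refine le_trans ?_ (bud2 hTA1)
      rw [if_pos (by push_cast; linarith), eθ]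
      refine cost_le_of_theta hθ1 ?_
      push_cast
      -- `(2lo+2K−T)·θ·ν(2lo) ≤ (1−θ)·(ν(2lo)(T−2lo) + ν(2lo+K)(T−2lo−K))`
      rcases le_total y (D / (2 * K)) with hle | hle
      · -- `θ = ρ`: the low's own lever suffices
        rw [max_eq_right hle]
        have hs : D / (2 * K) * ((2 * (lo : ℝ) + 2 * K) - 2 * (lo : ℝ)) ≤ T - 2 * (lo : ℝ) := by
          have e : (2 * (lo : ℝ) + 2 * K) - 2 * (lo : ℝ) = 2 * K := by ring
          rw [e, div_mul_cancel₀ _ hK20.ne', hD]; linarith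
        have c := pieceBlob_costA (lo := 2 * (lo : ℝ)) hs (g0 (2 * lo))
        have hpos : 0 ≤ (1 - D / (2 * K)) * (ν (2 * lo + K) * (T - (2 * (lo : ℝ) + K))) :=
          mul_nonneg (by linarith) (mul_nonneg (g0 _) (by linarith))
        linarith
      · -- `θ = y`: a concave quadratic in `T` on `[τ, T₀]` (`pairHubLong_costTop`)
        rw [max_eq_left hle, v0, v1]
        have hbrRaw : (K : ℝ) * (g * (1 - h) + h * (1 - g)) < (T - 4 * (lo : ℝ)) * ((1 - g) * (1 - h) + (g * (1 - h) + h * (1 - g))) := by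
          have h := hbr'; rw [hD, hW, hu0, hu1] at h; exact h
        have hTleRaw : T ≤ 2 * (lo : ℝ) + K * (g + h) := by have h := hTle; rw [hT₀] at h; exact h
        have hΨT := pairHubLong_costTop (lo : ℝ) K g h x T hlo0 hK2R hK4R hg hgh hh1 hx0 hxg hbrRaw hTleRaw
        rw [← hu0, ← hu1, ← hT₀] at hΨT
        -- back to the gated quantities: `xT = yT₀`, masses `a·uᵢ`
        have exT : x * T = y * T₀ := by rw [hy, hT]; ring
        set R : ℝ := (1 - y) * (u0 * (T - 2 * lo) + u1 * (T - (2 * lo + K))) - (2 * lo + 2 * K - T) * y * u0 with hR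
        have e : (T₀ - x * T) * (u0 * (T - 2 * lo) + u1 * (T - (2 * lo + K))) - (2 * lo + 2 * K - T) * (x * T) * u0 = T₀ * R := by
          rw [hR, exT]; ring
        have hR0 : 0 ≤ T₀ * R := by rw [← e]; exact hΨT
        have h6 : 0 ≤ R := nonneg_of_mul_nonneg_right hR0 hT0p
        have h7 : 0 ≤ a * R := mul_nonneg ha0.le h6
        rw [hR] at h7
        linarith [h7]


end LawDec
end Quant
end Summit.CriticalPhenomena.PercolationContinuityZ3.Theorems
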